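import Summits.BirchSwinnertonDyer.BirchSwinnertonDyer.Theses.SignedBaseChange
import HarnessLib

/-!
# `SignedBaseChange.SignedDescentFromGreenbergProductOfFrames` holds (route SignedBaseChange, glue of the gen-2 split of K2)

The glued split `GreenbergFramesAtSupersingular → SignedDescentFromGreenbergFrames → SignedDescentFromGreenbergProduct`
(F → K2R → K2) is modus ponens: K2R is K2 with the frame-existence item F as an explicit hypothesis placed after
Kobayashi's two inputs. Statement printed fully qualified.
File with: `ledger propose --kind proof --target Summits/BirchSwinnertonDyer/BirchSwinnertonDyer/Theorems/SignedBaseChangeK2SplitGlue.lean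
  --file <this> --workitem <glue item>`.
-/

set_option autoImplicit false

namespace Summit.BirchSwinnertonDyer.BirchSwinnertonDyer.Theorems.SignedBaseChangeK2SplitGlue

/-- The split glue F → K2R → K2. -/
theorem signedDescentFromGreenbergProductOfFrames_holds :
    Summit.BirchSwinnertonDyer.BirchSwinnertonDyer.Theses.SignedBaseChange.SignedDescentFromGreenbergProductOfFrames :=
  fun hF h h41 h12 => h h41 h12 hF

end Summit.BirchSwinnertonDyer.BirchSwinnertonDyer.Theorems.SignedBaseChangeK2SplitGlue
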